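import Mathlib
import HarnessLib
import Summits.NavierStokesRegularity.FluidComputer.TriggeredTransferClock
import Summits.NavierStokesRegularity.FluidComputer.TriggeredTransferZoom
import Summits.NavierStokesRegularity.FluidComputer.TriggeredTransferDataZoom

/-!
# The pieces of a linked run at their physical scale: zoomed classical solutions, their triggers,
# energies, hand-over identities, and the identification on the unforced overlaps

Cell `ns-blowup`, seat `ns-blowup-fc-prover-1` (D-0074 GROUP C «bridge support», door N1-FC); fourth
file of the cascade-gluing argument over `TriggeredTransfer.lean` (`TriggeredTransferRun`,
`TriggeredTransferClock`, `TriggeredTransferZoom`; the data zoom `zoom c x₀ w` is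
`TriggeredTransferDataZoom`, seat `ns-blowup-fc-prover-2`). LABEL: E–C bookkeeping. WHAT THIS IS NOT:
not Navier–Stokes evidence and not a construction — every statement is about a `TriggerScheme.Run ν`,
a type inhabited only under the OPEN predicate `TriggerScheme.Transfers ν`; no instance is claimed.

Level `n` of a run `ρ` is the unit-scale triggered transfer `(ρ.link n).u, .p` forced by the trigger
`(ρ.link n).g` on `[0, T_n + δ_n]`. Its PHYSICAL copy is the Leray zoom by `mag n = λⁿ` about the
centre `centre n`, started at `start n`:
`vel n t x = λⁿ • u_n (λ^{2n} (t - start n)) (λⁿ • (x - centre n))` (pressure `× λ^{2n}`, force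
`× λ^{3n}`), an exact classical solution with the SAME viscosity on
`[start n, start n + dur n + margin n]` (`piece_classical`, by `IsClassicalNSSolutionOn.stRescale`).
Proved here:

* values: `vel n (start n) = zoom (mag n) (centre n) (w n)` and the EXACT HAND-OVER
  `vel n (start (n+1)) = zoom (mag (n+1)) (centre (n+1)) (w (n+1)) = vel (n+1) (start (n+1))`;
* the zoomed trigger `frc n` is off before `start n + margin n`, from `start (n+1)` on, and outside
  the blow-up ball `B̄(0, ballRadius)`; it is smooth with
  `‖D^m (frc n)‖ ≤ A_m · (mag n)^{3+2m} · ε_n` (`norm_iteratedFDeriv_frc_le`) — summable in `n`;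
* finite energy of every physical piece on its slab (`piece_energy`, energy `× λ^{-n}`);
* **the junction** (`vel_eq_vel_succ`): on the overlap `[start (n+1), stop n]` both pieces are
  UNFORCED classical finite-energy solutions from the same zoomed Clay datum, hence EQUAL by Tao's
  unconditional uniqueness (Anal. PDE 2013, Cor. 11.4) — the tree THEOREM
  `tao_unconditional_uniqueness_velocity_holds`; no named fact is assumed.

References: J. Leray, Acta Math. 63 (1934) §20; T. Tao, Anal. PDE 6 (2013) Cor. 11.4; T. Tao,
J. Amer. Math. Soc. 29 (2016) §1.3. 0 sorry; axioms ⊆ {propext, Classical.choice, Quot.sound}.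
-/

noncomputable section

namespace Summit.NavierStokesRegularity.FluidComputer.TriggeredTransfer.TriggerScheme.Run

open Set Filter Function MeasureTheory
open scoped Topology ENNReal ContDiff
open Literature.Analysis.FluidPDE
open Literature.Analysis.FluidPDE.FluidComputer (E3 Vel)

variable {𝒮 : TriggerScheme} {ν : ℝ} (ρ : 𝒮.Run ν)

/-! ## The physical pieces -/

/-- **Velocity of the physical piece of level `n`**: the Leray zoom
`(t, x) ↦ λⁿ • u_n (λ^{2n} (t - start n)) (λⁿ • (x - centre n))` of the unit-scale piece. [cite: Leray1934, §20] -/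
def vel (n : ℕ) : ℝ → Vel :=
  𝒮.mag n • stPull (𝒮.mag n ^ 2) (𝒮.mag n) (-(𝒮.mag n ^ 2 * ρ.start n)) (-(𝒮.mag n • ρ.centre n))
    (ρ.link n).u

/-- **Pressure of the physical piece of level `n`** (`× λ^{2n}`). [cite: Leray1934, §20] -/
def prs (n : ℕ) : ℝ → E3 → ℝ :=
  𝒮.mag n ^ 2 • stPull (𝒮.mag n ^ 2) (𝒮.mag n) (-(𝒮.mag n ^ 2 * ρ.start n)) (-(𝒮.mag n • ρ.centre n))
    (ρ.link n).p

/-- **The zoomed trigger of level `n`** (`× λ^{3n}`). [cite: Leray1934, §20] -/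
def frc (n : ℕ) : ℝ → Vel :=
  (𝒮.mag n ^ 2 * 𝒮.mag n) • stPull (𝒮.mag n ^ 2) (𝒮.mag n) (-(𝒮.mag n ^ 2 * ρ.start n))
    (-(𝒮.mag n • ρ.centre n)) (ρ.link n).g

/-- The affine time argument of the zoom, simplified. [folklore] -/
theorem zoom_time (n : ℕ) (t : ℝ) :
    -(𝒮.mag n ^ 2 * ρ.start n) + 𝒮.mag n ^ 2 * t = 𝒮.mag n ^ 2 * (t - ρ.start n) := by ring

/-- The affine space argument of the zoom, simplified. [folklore] -/
theorem zoom_space (n : ℕ) (x : E3) :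
    -(𝒮.mag n • ρ.centre n) + 𝒮.mag n • x = 𝒮.mag n • (x - ρ.centre n) := by
  rw [smul_sub]; abel

/-- Unfolding `vel`. [folklore] -/
theorem vel_apply (n : ℕ) (t : ℝ) (x : E3) :
    ρ.vel n t x = 𝒮.mag n • (ρ.link n).u (𝒮.mag n ^ 2 * (t - ρ.start n)) (𝒮.mag n • (x - ρ.centre n)) := by
  simp only [vel, Pi.smul_apply, stPull_apply, ρ.zoom_time, ρ.zoom_space]

/-- Unfolding `prs`. [folklore] -/
theorem prs_apply (n : ℕ) (t : ℝ) (x : E3) :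
    ρ.prs n t x =
      𝒮.mag n ^ 2 • (ρ.link n).p (𝒮.mag n ^ 2 * (t - ρ.start n)) (𝒮.mag n • (x - ρ.centre n)) := by
  simp only [prs, Pi.smul_apply, stPull_apply, ρ.zoom_time, ρ.zoom_space]

/-- Unfolding `frc`. [folklore] -/
theorem frc_apply (n : ℕ) (t : ℝ) (x : E3) :
    ρ.frc n t x = (𝒮.mag n ^ 2 * 𝒮.mag n) •
      (ρ.link n).g (𝒮.mag n ^ 2 * (t - ρ.start n)) (𝒮.mag n • (x - ρ.centre n)) := by
  simp only [frc, Pi.smul_apply, stPull_apply, ρ.zoom_time, ρ.zoom_space]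

/-- The time slices of the physical velocity are data zooms of the unit-scale slices:
`vel n t = zoom (mag n) (centre n) (u_n (λ^{2n} (t - start n)))`. [folklore] -/
theorem vel_eq_zoom (n : ℕ) (t : ℝ) :
    ρ.vel n t = zoom (𝒮.mag n) (ρ.centre n) ((ρ.link n).u (𝒮.mag n ^ 2 * (t - ρ.start n))) := by
  funext x
  rw [vel_apply, zoom_apply]

/-! ## The physical pieces are classical solutions -/

/-- The zoom maps the physical slab onto the unit-scale slab:
`{t | -λ^{2n} start n + λ^{2n} t ∈ [0, T_n + δ_n]} = [start n, start n + dur n + margin n]`. [folklore] -/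
theorem preimage_slab (n : ℕ) :
    (fun r => -(𝒮.mag n ^ 2 * ρ.start n) + 𝒮.mag n ^ 2 * r) ⁻¹' Icc 0 ((ρ.link n).T + (ρ.link n).δ) =
      Icc (ρ.start n) (ρ.start n + ρ.dur n + ρ.margin n) := by
  have hm : 𝒮.mag n ^ 2 ≠ 0 := (pow_pos (𝒮.mag_pos n) 2).ne'
  rw [preimage_affine_Icc (pow_pos (𝒮.mag_pos n) 2)]
  have ha : (0 - -(𝒮.mag n ^ 2 * ρ.start n)) / 𝒮.mag n ^ 2 = ρ.start n := by
    rw [div_eq_iff hm]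
    ring
  have hb : ((ρ.link n).T + (ρ.link n).δ - -(𝒮.mag n ^ 2 * ρ.start n)) / 𝒮.mag n ^ 2 =
      ρ.start n + ρ.dur n + ρ.margin n := by
    rw [div_eq_iff hm, add_mul, add_mul, mul_comm (ρ.dur n), ρ.mag_sq_mul_dur, mul_comm (ρ.margin n),
      ρ.mag_sq_mul_margin]
    ring
  rw [ha, hb]

/-- Local (unit-scale) time of a physical time in the slab of level `n` lies in `[0, T_n + δ_n]`. [folklore] -/
theorem loc_mem (n : ℕ) {t : ℝ} (ht : t ∈ Icc (ρ.start n) (ρ.start n + ρ.dur n + ρ.margin n)) :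
    𝒮.mag n ^ 2 * (t - ρ.start n) ∈ Icc 0 ((ρ.link n).T + (ρ.link n).δ) := by
  have h := ρ.preimage_slab n
  have ht' : t ∈ (fun r => -(𝒮.mag n ^ 2 * ρ.start n) + 𝒮.mag n ^ 2 * r) ⁻¹'
      Icc 0 ((ρ.link n).T + (ρ.link n).δ) := by rw [h]; exact ht
  simpa only [mem_preimage, ρ.zoom_time] using ht'

/-- **The physical piece of level `n` is an exact classical solution** of the system forced by the
zoomed trigger, with the SAME viscosity, on `[start n, start n + dur n + margin n]`
(`IsClassicalNSSolutionOn.stRescale` with `α = γ = λⁿ`, `β = λ^{2n}`). [cite: Leray1934, §20] -/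
theorem piece_classical (n : ℕ) :
    IsClassicalNSSolutionOn (Icc (ρ.start n) (ρ.start n + ρ.dur n + ρ.margin n)) ν (ρ.frc n)
      (ρ.vel n) (ρ.prs n) := by
  have key := (ρ.link n).classical.stRescale (𝒮.mag_pos n) (𝒮.mag_pos n) (sq (𝒮.mag n))
    (-(𝒮.mag n ^ 2 * ρ.start n)) (-(𝒮.mag n • ρ.centre n))
  have hν : 𝒮.mag n * ν / 𝒮.mag n = ν := by
    field_simp [(𝒮.mag_pos n).ne']
  rw [ρ.preimage_slab n, hν] at key
  exact key

/-! ## Values: the start slice and the exact hand-over -/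

/-- The physical piece of level `n` starts from the zoomed level state:
`vel n (start n) = zoom (mag n) (centre n) (w n)`. [folklore] -/
theorem vel_start (n : ℕ) : ρ.vel n (ρ.start n) = zoom (𝒮.mag n) (ρ.centre n) (ρ.w n) := by
  rw [vel_eq_zoom, sub_self, mul_zero, ρ.u_zero]

/-- The zoom about the next centre, unfolded at the parent's scale:
`λ • (λⁿ • (x - centre n) - x₀_n) = λ^{n+1} • (x - centre (n+1))`. [folklore] -/
theorem lam_smul_sub_x₀ (n : ℕ) (x : E3) :
    𝒮.lam • (𝒮.mag n • (x - ρ.centre n) - (ρ.link n).x₀) =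
      𝒮.mag (n + 1) • (x - ρ.centre (n + 1)) := by
  have hm : 𝒮.mag n ≠ 0 := (𝒮.mag_pos n).ne'
  have h1 : 𝒮.mag n • (x - ρ.centre (n + 1)) = 𝒮.mag n • (x - ρ.centre n) - (ρ.link n).x₀ := by
    rw [ρ.centre_succ, sub_add_eq_sub_sub, smul_sub (𝒮.mag n) (x - ρ.centre n), smul_smul,
      mul_inv_cancel₀ hm, one_smul]
  rw [𝒮.mag_succ, mul_comm, ← smul_smul, h1]

/-- **The exact hand-over at physical scale**: at `start (n+1)` the piece of level `n` IS the zoomed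
next level state, `vel n (start (n+1)) = zoom (mag (n+1)) (centre (n+1)) (w (n+1))`. [folklore] -/
theorem vel_start_succ (n : ℕ) :
    ρ.vel n (ρ.start (n + 1)) = zoom (𝒮.mag (n + 1)) (ρ.centre (n + 1)) (ρ.w (n + 1)) := by
  rw [vel_eq_zoom, ρ.start_succ, add_sub_cancel_left, ρ.mag_sq_mul_dur, ρ.handover n]
  funext x
  simp only [zoom_apply]
  rw [smul_smul, ← 𝒮.mag_succ, ρ.lam_smul_sub_x₀]

/-- The two consecutive pieces agree at the hand-over time (no uniqueness needed). [folklore] -/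
theorem vel_start_succ_eq (n : ℕ) : ρ.vel n (ρ.start (n + 1)) = ρ.vel (n + 1) (ρ.start (n + 1)) := by
  rw [vel_start_succ, vel_start]

/-- The datum at a hand-over is a Clay datum (zoom of a member). [folklore] -/
theorem clay_vel_start (n : ℕ) :
    ContDiff ℝ ∞ (ρ.vel n (ρ.start n)) ∧ NSWave0.IsDivFree (ρ.vel n (ρ.start n)) ∧
      HasRapidSpatialDecay (ρ.vel n (ρ.start n)) := by
  rw [vel_start]
  exact clay_zoom ⟨ρ.contDiff_w n, ρ.isDivFree_w n, ρ.hasRapidSpatialDecay_w n⟩ (𝒮.mag_pos n) _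

/-! ## The zoomed triggers: support and size -/

/-- The zoomed trigger of level `n` is OFF during the initial layer: `t ≤ start n + margin n`. [folklore] -/
theorem frc_eq_zero_of_le {n : ℕ} {t : ℝ} (ht : t ≤ ρ.start n + ρ.margin n) : ρ.frc n t = 0 := by
  have hloc : 𝒮.mag n ^ 2 * (t - ρ.start n) ≤ (ρ.link n).δ := by
    calc 𝒮.mag n ^ 2 * (t - ρ.start n) ≤ 𝒮.mag n ^ 2 * ρ.margin n :=
          mul_le_mul_of_nonneg_left (by linarith) (pow_pos (𝒮.mag_pos n) 2).le
      _ = (ρ.link n).δ := ρ.mag_sq_mul_margin n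
  funext x
  rw [frc_apply, (ρ.link n).g_eq_zero_of_le_δ hloc, Pi.zero_apply, smul_zero, Pi.zero_apply]

/-- The zoomed trigger of level `n` is OFF from the hand-over on: `start (n+1) ≤ t`. [folklore] -/
theorem frc_eq_zero_of_ge {n : ℕ} {t : ℝ} (ht : ρ.start (n + 1) ≤ t) : ρ.frc n t = 0 := by
  have hloc : (ρ.link n).T ≤ 𝒮.mag n ^ 2 * (t - ρ.start n) := by
    rw [ρ.start_succ] at ht
    calc (ρ.link n).T = 𝒮.mag n ^ 2 * ρ.dur n := (ρ.mag_sq_mul_dur n).symm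
      _ ≤ 𝒮.mag n ^ 2 * (t - ρ.start n) :=
          mul_le_mul_of_nonneg_left (by linarith) (pow_pos (𝒮.mag_pos n) 2).le
  funext x
  rw [frc_apply, (ρ.link n).g_eq_zero_of_T_le hloc, Pi.zero_apply, smul_zero, Pi.zero_apply]

/-- The zoomed trigger of level `n` vanishes outside the blow-up ball `B̄(0, ballRadius)`. [folklore] -/
theorem frc_apply_eq_zero_of_far {n : ℕ} (t : ℝ) {x : E3} (hx : 𝒮.ballRadius ≤ ‖x‖) :
    ρ.frc n t x = 0 := by
  rw [frc_apply, (ρ.link n).trigger.off_far _ _ (ρ.R_le_norm_mag_smul_sub n hx), smul_zero]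

/-- The zoomed trigger is a smooth space–time field. [folklore] -/
theorem contDiff_frc (n : ℕ) : ContDiff ℝ ∞ (uncurry (ρ.frc n)) :=
  contDiff_uncurry_smul_stPull (ρ.link n).trigger.smooth _ _ _ _ _

/-- **`C^m` size of the zoomed trigger**: `‖D^m (frc n) (z)‖ ≤ A_m · (mag n)^{3+2m} · ε_n` — the
amplitude `λ^{3n}`, `λ^{2n}` per derivative from the zoom, and the seed's `‖D^m g_n‖ ≤ ε_n A_m`. [folklore] -/
theorem norm_iteratedFDeriv_frc_le (n m : ℕ) (z : ℝ × E3) :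
    ‖iteratedFDeriv ℝ m (uncurry (ρ.frc n)) z‖ ≤
      𝒮.A m * (𝒮.mag n ^ (3 + 2 * m) * 𝒮.seedAt ν n (ρ.U n)) := by
  have hψ : ContDiff ℝ m (uncurry (ρ.link n).g) :=
    (ρ.link n).trigger.smooth.of_le (by exact_mod_cast le_top)
  have hm1 : 1 ≤ 𝒮.mag n := 𝒮.one_le_mag n
  have hmax : max (𝒮.mag n ^ 2) (𝒮.mag n) = 𝒮.mag n ^ 2 :=
    max_eq_left (by nlinarith)
  refine (norm_iteratedFDeriv_smul_stPull_le hψ _ (pow_pos (𝒮.mag_pos n) 2).le (𝒮.mag_pos n).le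
    _ _ z).trans ?_
  rw [hmax, abs_of_pos (mul_pos (pow_pos (𝒮.mag_pos n) 2) (𝒮.mag_pos n))]
  have hsmall := (ρ.link n).trigger.small m
    (-(𝒮.mag n ^ 2 * ρ.start n) + 𝒮.mag n ^ 2 * z.1, -(𝒮.mag n • ρ.centre n) + 𝒮.mag n • z.2)
  calc 𝒮.mag n ^ 2 * 𝒮.mag n * (𝒮.mag n ^ 2) ^ m *
        ‖iteratedFDeriv ℝ m (uncurry (ρ.link n).g)
          (-(𝒮.mag n ^ 2 * ρ.start n) + 𝒮.mag n ^ 2 * z.1, -(𝒮.mag n • ρ.centre n) + 𝒮.mag n • z.2)‖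
      ≤ 𝒮.mag n ^ 2 * 𝒮.mag n * (𝒮.mag n ^ 2) ^ m * (𝒮.seedAt ν n (ρ.U n) * 𝒮.A m) :=
        mul_le_mul_of_nonneg_left hsmall (by positivity)
    _ = 𝒮.A m * (𝒮.mag n ^ (3 + 2 * m) * 𝒮.seedAt ν n (ρ.U n)) := by ring

/-- **Summable `C^m` sizes**: for every `m`, the bounds `A_m (mag n)^{3+2m} ε_n` of the zoomed
triggers are summable in the level (`ν > 0`). [folklore] -/
theorem summable_frc_bound (hν : 0 < ν) (m : ℕ) :
    Summable (fun n : ℕ => 𝒮.A m * (𝒮.mag n ^ (3 + 2 * m) * 𝒮.seedAt ν n (ρ.U n))) :=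
  (ρ.summable_mag_pow_mul_seedAt hν (3 + 2 * m)).mul_left _

/-! ## Energies -/

/-- **Finite energy of the physical pieces**: on its slab the piece of level `n` has
`∫ ‖vel n t‖² ≤ λ^{2n} λ^{-3n} C_n < ∞`. [folklore] -/
theorem piece_energy (n : ℕ) :
    ∃ C : ℝ≥0∞, C < ⊤ ∧ ∀ t ∈ Icc (ρ.start n) (ρ.start n + ρ.dur n + ρ.margin n),
      ∫⁻ x, ‖ρ.vel n t x‖ₑ ^ 2 ≤ C := by
  obtain ⟨C, hC, hb⟩ := (ρ.link n).energy
  refine ⟨ENNReal.ofReal (𝒮.mag n ^ 2) * ENNReal.ofReal (𝒮.mag n ^ 3)⁻¹ * C,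
    ENNReal.mul_lt_top (ENNReal.mul_lt_top ENNReal.ofReal_lt_top ENNReal.ofReal_lt_top) hC,
    fun t ht => ?_⟩
  rw [ρ.vel_eq_zoom, lintegral_enorm_sq_zoom (𝒮.mag_pos n)]
  exact mul_le_mul' le_rfl (hb _ (ρ.loc_mem n ht))

/-- Finite energy of a physical piece, after a time translation, on a sub-slab. [folklore] -/
theorem piece_energy_translate (n : ℕ) {a τ : ℝ} (ha : ρ.start n ≤ a)
    (hτ : a + τ ≤ ρ.start n + ρ.dur n + ρ.margin n) :
    ∃ C : ℝ≥0∞, C < ⊤ ∧ ∀ s ∈ Icc 0 τ, ∫⁻ x, ‖ρ.vel n (s + a) x‖ₑ ^ 2 ≤ C := by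
  obtain ⟨C, hC, hb⟩ := ρ.piece_energy n
  exact ⟨C, hC, fun s hs => hb (s + a) ⟨by linarith [hs.1], by linarith [hs.2]⟩⟩

/-! ## The junction: consecutive pieces agree on the unforced overlap -/

/-- The piece of level `n`, translated to start the clock at `a ≥ start (n+1)`, is an UNFORCED
classical solution on `[0, τ]` as long as `a + τ` stays in its slab. [folklore] -/
theorem piece_unforced_late (n : ℕ) {a τ : ℝ} (ha : ρ.start (n + 1) ≤ a) (hτ : 0 < τ)
    (hlife : a + τ ≤ ρ.start n + ρ.dur n + ρ.margin n) :
    IsClassicalNSSolutionOn (Icc 0 τ) ν 0 (fun s => ρ.vel n (s + a)) (fun s => ρ.prs n (s + a)) := by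
  have h := (ρ.piece_classical n).comp_add_right a
  have hsub : Icc 0 τ ⊆ (· + a) ⁻¹' Icc (ρ.start n) (ρ.start n + ρ.dur n + ρ.margin n) := by
    intro s hs
    simp only [mem_preimage, mem_Icc]
    constructor
    · linarith [hs.1, ρ.start_lt_start_succ n]
    · linarith [hs.2]
  refine (h.mono hsub (uniqueDiffOn_Icc hτ)).force_congr fun s hs => ?_
  show ρ.frc n (s + a) = 0
  exact ρ.frc_eq_zero_of_ge (by linarith [hs.1])

/-- The piece of level `n+1`, translated to start the clock at `a ≥ start (n+1)`, is an UNFORCED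
classical solution on `[0, τ]` as long as `a + τ ≤ start (n+1) + margin (n+1)`. [folklore] -/
theorem piece_unforced_early (n : ℕ) {a τ : ℝ} (ha : ρ.start (n + 1) ≤ a) (hτ : 0 < τ)
    (hearly : a + τ ≤ ρ.start (n + 1) + ρ.margin (n + 1)) :
    IsClassicalNSSolutionOn (Icc 0 τ) ν 0 (fun s => ρ.vel (n + 1) (s + a))
      (fun s => ρ.prs (n + 1) (s + a)) := by
  have h := (ρ.piece_classical (n + 1)).comp_add_right a
  have hsub : Icc 0 τ ⊆
      (· + a) ⁻¹' Icc (ρ.start (n + 1)) (ρ.start (n + 1) + ρ.dur (n + 1) + ρ.margin (n + 1)) := by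
    intro s hs
    simp only [mem_preimage, mem_Icc]
    constructor
    · linarith [hs.1]
    · linarith [hs.2, (ρ.dur_pos (n + 1)).le]
  refine (h.mono hsub (uniqueDiffOn_Icc hτ)).force_congr fun s hs => ?_
  show ρ.frc (n + 1) (s + a) = 0
  exact ρ.frc_eq_zero_of_le (by linarith [hs.2])

/-- **THE JUNCTION.** On the overlap `[start (n+1), stop n]` the physical pieces of levels `n` and
`n+1` COINCIDE: both are unforced there (`frc n` is off from `start (n+1)` on, `frc (n+1)` is off
until `start (n+1) + margin (n+1) ≥ stop n`), both are classical with finite energy, and both start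
at `start (n+1)` from the same zoomed Clay datum (`vel_start_succ_eq`; `H¹` by
`ClayUniqueness.memLp_two_of_rapidDecay`); Tao's unconditional uniqueness (Anal. PDE 2013,
Cor. 11.4 — the tree theorem `tao_unconditional_uniqueness_velocity_holds`) identifies them.
[cite: Tao2011, Cor. 11.4] -/
theorem vel_eq_vel_succ (hν : 0 < ν) (n : ℕ) {t : ℝ}
    (ht : t ∈ Icc (ρ.start (n + 1)) (ρ.stop n)) : ρ.vel n t = ρ.vel (n + 1) t := by
  rcases ht.1.eq_or_lt with h | h
  · rw [← h, vel_start_succ_eq]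
  · have hτ : 0 < t - ρ.start (n + 1) := sub_pos.2 h
    have hlife : ρ.start (n + 1) + (t - ρ.start (n + 1)) ≤ ρ.start n + ρ.dur n + ρ.margin n := by
      linarith [ρ.stop_le_life n, ht.2]
    have hearly : ρ.start (n + 1) + (t - ρ.start (n + 1)) ≤ ρ.start (n + 1) + ρ.margin (n + 1) := by
      linarith [ρ.stop_le_start_succ_add_margin n, ht.2]
    have h1 := ρ.piece_unforced_late n le_rfl hτ hlife
    have h2 := ρ.piece_unforced_early n le_rfl hτ hearly
    -- the common datum
    obtain ⟨hC, -, hdec⟩ := ρ.clay_vel_start (n + 1)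
    obtain ⟨hL2, hH1⟩ :=
      Summit.NavierStokesRegularity.NavierStokesRegularity.Theorems.ClayUniqueness.memLp_two_of_rapidDecay
        hdec (hC.of_le (by norm_cast))
    have hv1 : (fun s => ρ.vel n (s + ρ.start (n + 1))) 0 = ρ.vel (n + 1) (ρ.start (n + 1)) := by
      simp only [zero_add]
      exact ρ.vel_start_succ_eq n
    have hv2 : (fun s => ρ.vel (n + 1) (s + ρ.start (n + 1))) 0 = ρ.vel (n + 1) (ρ.start (n + 1)) := by
      simp only [zero_add]
    -- the energies
    have hE1 := ρ.piece_energy_translate n (ρ.start_lt_start_succ n).le hlife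
    have hE2 := ρ.piece_energy_translate (n + 1) le_rfl
      (hearly.trans (by linarith [(ρ.dur_pos (n + 1)).le]))
    have key := tao_unconditional_uniqueness_velocity_holds ν (t - ρ.start (n + 1)) hν hτ _ hL2 hH1
      _ _ _ _ h1 h2 hv1 hv2 hE1 hE2 (t - ρ.start (n + 1)) ⟨hτ.le, le_rfl⟩
    simpa only [sub_add_cancel] using key

/-- The junction on the open overlap (the form `IsClassicalNSSolutionOn.glue` consumes). [cite: Tao2011, Cor. 11.4] -/
theorem vel_eq_vel_succ_Ioo (hν : 0 < ν) (n : ℕ) {t : ℝ}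
    (ht : t ∈ Ioo (ρ.start (n + 1)) (ρ.stop n)) : ρ.vel n t = ρ.vel (n + 1) t :=
  ρ.vel_eq_vel_succ hν n ⟨ht.1.le, ht.2.le⟩

end Summit.NavierStokesRegularity.FluidComputer.TriggeredTransfer.TriggerScheme.Run

end
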